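import Summits.Parity.GeneralizedHardyLittlewood.Theorems.PrimeLevelFamEdgeIdeaDeltasWucSigmaDoor
import Literature.NumberTheory.LFunctions.ConreyIwaniec2002ThmOneOneWeak
import Literature.NumberTheory.LFunctions.ConreyIwaniec2002Corollary63Large
import Literature.NumberTheory.LFunctions.LOneLowerBoundOddLevelHalves
import HarnessLib

/-!
# Route `PrimeLevelFamEdge` — deck 19b RE-THREADED on the weak Theorem 1.1 (`(log q)^{−(2A+7)}`, `q` odd):
# the (κ,σ)-edge door at `(log q)^{−(4A+19)}`, the odd-LEVEL odd half of the leaf for `N ≥ 4A+19`,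
# Conrey–Iwaniec's interior point at `76`, and the same BY NAME from the typed Proposition 8.1

Cell landau-siegel/ls-inputs, unit `ls-inputs-I8w-typ1` (K-INPUTS-5: the `−(2A+7)` cascade of the
findings-register entry F-S3/CI-(9.11); exponent map plan-1 A2.4). Deck 19b
(`PrimeLevelFamEdgeIdeaDeltasWucSigmaDoor.lean`, K-L24-1 «the door has an edge») composes the
(κ,σ)-edge hypothesis `SubnormalGapsHypothesisSigma κ σ` with the NAMED FACT
`conreyIwaniec2002_theorem11` (Theorem 1.1 AS PRINTED, exponent `−(2A+6)`, no parity restriction on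
`q`). For the kernel chain that fact is superseded by `conreyIwaniec2002_theorem11_weak`
(`ConreyIwaniec2002ThmOneOneWeak.lean`: exponent `−(2A+7)`, `q` odd — the form the typed
Proposition 9.1 delivers WITHOUT the unlocated claim of (9.11); PROVED from the typed Proposition 8.1
alone, `conreyIwaniec2002_theorem11_weak_of_proposition81`). This file runs deck 19b §3/§5 on the
weak fact; the compositions are exponent-transparent, so every exponent moves by exactly one power of
`log q`, and the scope `q` odd of Conrey–Iwaniec §§7–10 becomes visible at the leaf:

* `lOne_lowerBound_of_sigma_weak` / `lOne_lowerBound_of_sigma'_weak` — K-L24-1 with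
  `(log q)^{−(4A+19)}` (deck 19b: `−(4A+18)`), same budget `κ + σ < A/(A+6)`, same choice
  `log T = (log q)^{A+6}`, `α = (log T)^{−σ}`, plus `Odd q`.
* `lOneLowerBound_oddLevel_of_sigma_weak` — the leaf's odd half AT ODD LEVEL for `N ≥ 4A+19`
  (deck 19b: `LOneLowerBoundOdd N` for `N ≥ 4A+18`); `…_2022_of_sigma_weak` on the edge
  `κ + σ < 2003/2027` (`A = 2003/4`; deck 19b: `501/507`); `…_76_of_subnormalGaps_weak`: `X` gives
  the odd-level odd half with exponent `76` (`A = 57/4`; deck 19b: `75`; printed Theorem 1.2: `90`).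
* `…_of_proposition81` — the three headline statements from `conreyIwaniec2002_proposition81` BY NAME,
  and `lOneLowerBoundOdd_76_of_subnormalGaps_of_proposition81_of_evenLevel` — the door of record as ONE
  statement: `X ∧ Prop 8.1 ∧ (the even-LEVEL odd-character bound at 76, hypothesis) ⟹
  LOneLowerBoundOdd 76`, which makes the parity caveat exact: `LOneLowerBoundOdd N` (all moduli
  `D ≥ 3`) is the odd-level statement AND its even-level sibling (odd characters of conductor `4m`),
  and the weak chain reaches the odd-level conjunct only (even `q` is outside Conrey–Iwaniec §7 and
  Propositions 8.1/9.1/10.1). The two level-halves are NAMED (`LOneLowerBoundOddOddLevel`,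
  `LOneLowerBoundOddEvenLevel`, with `LOneLowerBoundOdd A ↔ … ∧ …`) in the companion Literature file
  `LOneLowerBoundOddLevelHalves.lean` of this unit; the conclusions below are spelled out so that this
  deck depends on tree files only.

SUPERSESSION, not correction: nothing audited is re-worded (deck 19b, `conreyIwaniec2002_theorem11`,
`LOneLowerBoundOdd` untouched); every declaration here is PROVED (compositions of tree theorems;
hypotheses `SubnormalGapsHypothesisSigma κ σ` / `SubnormalGapsHypothesis c` (= `X`) and the weak
Theorem 1.1 or the typed Proposition 8.1 are explicit binders). Typed ≠ proved: nothing here proves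
`X`, any rung, the odd leaf unconditionally, Theorem 1.2's (1.22), or any exceptional-zero /
Landau–Siegel statement.

## References
* [ConreyIwaniec2002] B. Conrey, H. Iwaniec, Acta Arith. 103 (2002) 259–312, arXiv:math/0111012:
  Theorem 1.1 (1.20)–(1.21), Theorem 1.2, Proposition 8.1, §10 Remark.
-/

noncomputable section

namespace Summit.Parity.GeneralizedHardyLittlewood.Theorems.PrimeLevelFamEdgeIdeaDeltas.WucSigma

open _root_.Complex NumberField Literature.NumberTheory.LFunctions.NumberField
open Literature.NumberTheory.LFunctions Literature.NumberTheory.LFunctions.ConreyIwaniec2002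

/-! ### §3w The edge opens the door through the WEAK Theorem 1.1: exponent `−(4A+19)`, `q` odd -/

/-- **K-L24-1 on the weak Theorem 1.1.** `H_Σ(κ,σ)` with `σ > 0` and `κ + σ < A/(A+6)` gives, through
`conreyIwaniec2002_theorem11_weak` at `ψ = 1` (hypothesis; exponent `−(2A+7)`, `q` odd) and the pair
transfer, `L(1,χ) ≥ (log q)^{−(4A+19)}` for every large ODD `q` and the odd primitive quadratic `χ`
mod `q`. Parameters as in `lOne_lowerBound_of_sigma`: `log T = (log q)^{A+6}` exactly,
`α = (log T)^{−σ}`; `(log T)^{−2}(log q)^{−(2A+7)} = (log q)^{−(4A+19)}`. The proof is deck 19b's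
verbatim with `Odd q` threaded and `18 ↦ 19`. -/
theorem lOne_lowerBound_of_sigma_weak {κ σ A : ℝ} (hA : 0 ≤ A) (hσ : 0 < σ)
    (hsum : κ + σ < A / (A + 6)) (hCI : conreyIwaniec2002_theorem11_weak)
    (h : SubnormalGapsHypothesisSigma κ σ) :
    ∃ q₀ : ℕ, ∀ (q : ℕ) [NeZero q], q₀ ≤ q → 4 < q → Odd q →
      ∀ χ : DirichletCharacter ℂ q, χ.IsPrimitive → χ.IsQuadratic → χ.Odd →
        ∀ (K : Type) [Field K] [NumberField K],
          Module.finrank ℚ K = 2 → NumberField.discr K = -(q : ℤ) → ZetaPairsTransfer K →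
            Real.log q ^ (-(4 * A + 19)) ≤ ‖χ.LFunction 1‖ := by
  obtain ⟨c, hc, hci⟩ := hCI
  obtain ⟨c₀, hc₀, T₀, hT₀⟩ := h
  obtain ⟨δ, hδ⟩ : ∃ δ : ℝ, A / (A + 6) - (κ + σ) = δ := ⟨_, rfl⟩
  have hδpos : 0 < δ := by rw [← hδ]; linarith
  obtain ⟨R₁, hR₁⟩ : ∃ R₁ : ℝ, (c / c₀) ^ δ⁻¹ = R₁ := ⟨_, rfl⟩
  obtain ⟨q₀, hq₀⟩ : ∃ q₀ : ℕ, max T₀ (Real.exp R₁) ≤ q₀ := exists_nat_ge _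
  refine ⟨q₀, fun q _ hq hq4 hoddq χ hprim hquad hodd K _ _ h2 hdisc htrans => ?_⟩
  have hqreal : (q₀ : ℝ) ≤ q := by exact_mod_cast hq
  have hq5 : (5 : ℝ) ≤ q := by exact_mod_cast (show 5 ≤ q by omega)
  have hqpos : (0 : ℝ) < q := by linarith
  obtain ⟨L, hL⟩ : ∃ L : ℝ, Real.log (q : ℝ) = L := ⟨_, rfl⟩
  have hL1 : 1 ≤ L := by
    rw [← hL, ← Real.log_exp 1]
    exact Real.log_le_log (Real.exp_pos 1) (by linarith [Real.exp_one_lt_d9])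
  have hLpos : 0 < L := by linarith
  obtain ⟨M, hM⟩ : ∃ M : ℝ, L ^ (A + 6) = M := ⟨_, rfl⟩
  have hM_ge_L : L ≤ M := by
    have := Real.rpow_le_rpow_of_exponent_le hL1 (show (1 : ℝ) ≤ A + 6 by linarith)
    rwa [Real.rpow_one, hM] at this
  have hM1 : 1 ≤ M := hL1.trans hM_ge_L
  have hMpos : 0 < M := by linarith
  obtain ⟨T, hT⟩ : ∃ T : ℝ, Real.exp M = T := ⟨_, rfl⟩
  have hTpos : 0 < T := by rw [← hT]; exact Real.exp_pos M
  have hlogT : Real.log T = M := by rw [← hT, Real.log_exp]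
  have hT2 : 2 ≤ T := by
    have h1 : Real.exp 1 ≤ T := by rw [← hT]; exact Real.exp_le_exp.2 hM1
    linarith [Real.add_one_le_exp (1 : ℝ)]
  have hTq : (q : ℝ) ≤ T := by
    have e : Real.exp L = q := by rw [← hL, Real.exp_log hqpos]
    rw [← e, ← hT]; exact Real.exp_le_exp.2 hM_ge_L
  have hTT₀ : T₀ ≤ T := le_trans (le_trans (le_max_left _ _) hq₀) (hqreal.trans hTq)
  obtain ⟨α, hα⟩ : ∃ α : ℝ, M ^ (-σ) = α := ⟨_, rfl⟩
  have hαpos : 0 < α := by rw [← hα]; exact Real.rpow_pos_of_pos hMpos _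
  have hα1 : α ≤ 1 := by
    rw [← hα]; exact Real.rpow_le_one_of_one_le_of_nonpos hM1 (by linarith)
  -- `H_Σ` at height `T`
  have hcount₀ := hT₀ T hTT₀
  rw [hlogT, hα] at hcount₀
  -- `c / c₀ ≤ M ^ δ` (this is where `q₀` is large)
  have hcc : c / c₀ ≤ M ^ δ := by
    have h1 : Real.exp R₁ ≤ q := le_trans (le_trans (le_max_right _ _) hq₀) hqreal
    have h2' : R₁ ≤ L := by
      rw [← hL, ← Real.log_exp R₁]; exact Real.log_le_log (Real.exp_pos _) h1
    have hR₁M : R₁ ≤ M := h2'.trans hM_ge_L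
    have hR₁nn : 0 ≤ R₁ := by rw [← hR₁]; exact Real.rpow_nonneg (div_pos hc hc₀).le _
    have h3 := Real.rpow_le_rpow hR₁nn hR₁M hδpos.le
    rwa [← hR₁, Real.rpow_inv_rpow (div_pos hc hc₀).le hδpos.ne'] at h3
  have hA6 : 0 < A + 6 := by linarith
  have hLA : L ^ A = M ^ (A / (A + 6)) := by
    rw [← hM, ← Real.rpow_mul hLpos.le]; congr 1; field_simp
  -- the Theorem-1.1 count hypothesis at `ψ = 1`
  have hcount : c * T * Real.log T / (α * Real.log q ^ A) ≤
      (closeZeroCount (classGroupLFunction K 1) α T : ℝ) := by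
    rw [hlogT, hL]
    have e1 : α * L ^ A = M ^ (A / (A + 6) - σ) := by
      rw [← hα, hLA, ← Real.rpow_add hMpos]; congr 1; ring
    have e2 : c * T * M / (α * L ^ A) = c * T * M ^ (1 - (A / (A + 6) - σ)) := by
      rw [e1, Real.rpow_sub hMpos 1 (A / (A + 6) - σ), Real.rpow_one]; ring
    have step : c * T * M ^ (1 - (A / (A + 6) - σ)) ≤ c₀ * T * M ^ (1 - κ) := by
      have e3 : M ^ (1 - κ) = M ^ δ * M ^ (1 - (A / (A + 6) - σ)) := by
        rw [← Real.rpow_add hMpos]; congr 1; rw [← hδ]; ring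
      rw [e3]
      have hc' : c ≤ c₀ * M ^ δ := by
        have h1 := mul_le_mul_of_nonneg_left hcc hc₀.le
        have e : c₀ * (c / c₀) = c := by field_simp
        linarith
      calc c * T * M ^ (1 - (A / (A + 6) - σ))
            = c * (T * M ^ (1 - (A / (A + 6) - σ))) := by ring
        _ ≤ (c₀ * M ^ δ) * (T * M ^ (1 - (A / (A + 6) - σ))) :=
            mul_le_mul_of_nonneg_right hc' (by positivity)
        _ = c₀ * T * (M ^ δ * M ^ (1 - (A / (A + 6) - σ))) := by ring
    rw [e2]
    exact step.trans (hcount₀.trans (htrans α T))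
  have key := hci A hA q hq4 hoddq χ hprim hquad hodd K h2 hdisc 1 T α hT2 hαpos hα1
    (le_of_eq (by rw [hlogT, hL, hM])) hcount
  have e4 : Real.log T ^ (-(2 : ℝ)) * Real.log (q : ℝ) ^ (-(2 * A + 7)) =
      Real.log (q : ℝ) ^ (-(4 * A + 19)) := by
    rw [hlogT, hL, ← hM, ← Real.rpow_mul hLpos.le, ← Real.rpow_add hLpos]; congr 1; ring
  rw [← e4]; exact key

/-- **The weak door, hypothesis-minimal form**: as `lOne_lowerBound_of_sigma_weak`, with the pair
transfer discharged for quadratic fields (`zetaPairsTransfer_of_quadratic`, deck 19b §4); only the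
weak Theorem 1.1 remains as a hypothesis. -/
theorem lOne_lowerBound_of_sigma'_weak {κ σ A : ℝ} (hA : 0 ≤ A) (hσ : 0 < σ)
    (hsum : κ + σ < A / (A + 6)) (hCI : conreyIwaniec2002_theorem11_weak)
    (h : SubnormalGapsHypothesisSigma κ σ) :
    ∃ q₀ : ℕ, ∀ (q : ℕ) [NeZero q], q₀ ≤ q → 4 < q → Odd q →
      ∀ χ : DirichletCharacter ℂ q, χ.IsPrimitive → χ.IsQuadratic → χ.Odd →
        ∀ (K : Type) [Field K] [NumberField K],
          Module.finrank ℚ K = 2 → NumberField.discr K = -(q : ℤ) →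
            Real.log q ^ (-(4 * A + 19)) ≤ ‖χ.LFunction 1‖ := by
  obtain ⟨q₀, hq₀⟩ := lOne_lowerBound_of_sigma_weak hA hσ hsum hCI h
  exact ⟨q₀, fun q _ hq hq4 hoddq χ hprim hquad hodd K _ _ h2 hdisc =>
    hq₀ q hq hq4 hoddq χ hprim hquad hodd K h2 hdisc (zetaPairsTransfer_of_quadratic K h2)⟩

/-- **The weak door from the typed Proposition 8.1 BY NAME** (`conreyIwaniec2002_proposition81`,
Conrey–Iwaniec §§5–8; Corollary 6.3 and the §§9–10 chain are tree theorems):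
`H_Σ(κ,σ) ∧ κ + σ < A/(A+6) ∧ Prop 8.1 ⟹ L(1,χ) ≥ (log q)^{−(4A+19)}` for large odd `q`. -/
theorem lOne_lowerBound_of_sigma_of_proposition81 {κ σ A : ℝ} (hA : 0 ≤ A) (hσ : 0 < σ)
    (hsum : κ + σ < A / (A + 6)) (h81 : conreyIwaniec2002_proposition81)
    (h : SubnormalGapsHypothesisSigma κ σ) :
    ∃ q₀ : ℕ, ∀ (q : ℕ) [NeZero q], q₀ ≤ q → 4 < q → Odd q →
      ∀ χ : DirichletCharacter ℂ q, χ.IsPrimitive → χ.IsQuadratic → χ.Odd →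
        ∀ (K : Type) [Field K] [NumberField K],
          Module.finrank ℚ K = 2 → NumberField.discr K = -(q : ℤ) →
            Real.log q ^ (-(4 * A + 19)) ≤ ‖χ.LFunction 1‖ :=
  lOne_lowerBound_of_sigma'_weak hA hσ hsum (conreyIwaniec2002_theorem11_weak_of_proposition81 h81) h

/-! ### §5w To the leaf's odd half AT ODD LEVEL: `H_Σ(κ,σ) ∧ κ+σ < A/(A+6) ∧ Thm 1.1-weak ⇒ (odd D) c₁/(log D)^N < ‖L(1,χ)‖`, `N ≥ 4A+19` -/

/-- **K-L24-1 reaches the odd-LEVEL part of the leaf's odd half.** `H_Σ(κ,σ)` (`σ > 0`), the budget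
`κ + σ < A/(A+6)`, an exponent `N ≥ 4A + 19` and the weak Theorem 1.1 give: there is `c₁ > 0` with
`c₁/(log D)^N < ‖L(1,χ)‖` for every ODD modulus `D ≥ 3` and every odd primitive quadratic `χ` mod `D`
— the binders of `LOneLowerBoundOdd N` with `Odd D` added (the scope of Conrey–Iwaniec §§7–10). The
field `K = ℚ(√−D)` comes from `exists_quadraticField_of_odd_primitive`; small conductors are absorbed
by `L(1,χ) ≠ 0` (`exists_lOne_lower_lt`). Deck 19b's `lOneLowerBoundOdd_of_sigma` verbatim with
`Odd D` threaded and `18 ↦ 19`. -/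
theorem lOneLowerBound_oddLevel_of_sigma_weak {κ σ A : ℝ} {N : ℕ} (hA : 0 ≤ A) (hσ : 0 < σ)
    (hsum : κ + σ < A / (A + 6)) (hN : 4 * A + 19 ≤ N) (hCI : conreyIwaniec2002_theorem11_weak)
    (h : SubnormalGapsHypothesisSigma κ σ) :
    ∃ c₁ : ℝ, 0 < c₁ ∧ ∀ (D : ℕ) [NeZero D] (χ : DirichletCharacter ℂ D),
      3 ≤ D → Odd D → χ.IsQuadratic → χ.IsPrimitive → χ.Odd →
        c₁ / Real.log D ^ N < ‖χ.LFunction 1‖ := by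
  obtain ⟨q₀, hq₀⟩ := lOne_lowerBound_of_sigma'_weak hA hσ hsum hCI h
  obtain ⟨m, hm, hsmall⟩ := exists_lOne_lower_lt (max q₀ 5)
  refine ⟨min (1 / 2) (m / 2), by positivity, fun D _ χ hD hDodd hq hp ho => ?_⟩
  have h3 : (3 : ℝ) ≤ D := by exact_mod_cast hD
  have hlog1 : 1 ≤ Real.log (D : ℝ) := by
    rw [← Real.log_exp 1]
    exact Real.log_le_log (Real.exp_pos 1) (by linarith [Real.exp_one_lt_d9])
  have hlogpos : 0 < Real.log (D : ℝ) := by linarith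
  have hpow1 : 1 ≤ Real.log (D : ℝ) ^ N := one_le_pow₀ hlog1
  have hpow : 0 < Real.log (D : ℝ) ^ N := by positivity
  by_cases hbig : max q₀ 5 ≤ D
  · have hq₀D : q₀ ≤ D := le_trans (le_max_left _ _) hbig
    have h4 : 4 < D := by have := le_trans (le_max_right _ _) hbig; omega
    obtain ⟨K, hF, hNF, h2, hdisc⟩ :=
      Literature.NumberTheory.QuadraticFields.Quadratic.exists_quadraticField_of_odd_primitive hp hq ho
    have key := hq₀ D hq₀D h4 hDodd χ hp hq ho K h2 hdisc
    have hle : (Real.log (D : ℝ) ^ N)⁻¹ ≤ Real.log (D : ℝ) ^ (-(4 * A + 19)) := by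
      rw [← Real.rpow_natCast, ← Real.rpow_neg hlogpos.le]
      exact Real.rpow_le_rpow_of_exponent_le hlog1 (by linarith)
    calc min (1 / 2) (m / 2) / Real.log D ^ N ≤ (1 / 2) / Real.log D ^ N :=
          div_le_div_of_nonneg_right (min_le_left _ _) hpow.le
      _ < 1 / Real.log D ^ N := by
          apply div_lt_div_of_pos_right _ hpow; norm_num
      _ = (Real.log (D : ℝ) ^ N)⁻¹ := one_div _
      _ ≤ Real.log (D : ℝ) ^ (-(4 * A + 19)) := hle
      _ ≤ ‖χ.LFunction 1‖ := key
  · push Not at hbig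
    have hχ1 : χ ≠ 1 := by
      rintro rfl
      have hc : DirichletCharacter.conductor (1 : DirichletCharacter ℂ D) = D := hp
      rw [DirichletCharacter.conductor_one] at hc
      omega
    have hmle := hsmall D χ hbig hχ1
    calc min (1 / 2) (m / 2) / Real.log D ^ N ≤ min (1 / 2) (m / 2) :=
          div_le_self (by positivity) hpow1
      _ ≤ m / 2 := min_le_right _ _
      _ < m := by linarith
      _ ≤ ‖χ.LFunction 1‖ := hmle

/-- **The odd-level odd half from the typed Proposition 8.1 BY NAME**:
`H_Σ(κ,σ) ∧ κ + σ < A/(A+6) ∧ N ≥ 4A+19 ∧ Prop 8.1 ⟹ (odd D) c₁/(log D)^N < ‖L(1,χ)‖`. -/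
theorem lOneLowerBound_oddLevel_of_sigma_of_proposition81 {κ σ A : ℝ} {N : ℕ} (hA : 0 ≤ A)
    (hσ : 0 < σ) (hsum : κ + σ < A / (A + 6)) (hN : 4 * A + 19 ≤ N)
    (h81 : conreyIwaniec2002_proposition81) (h : SubnormalGapsHypothesisSigma κ σ) :
    ∃ c₁ : ℝ, 0 < c₁ ∧ ∀ (D : ℕ) [NeZero D] (χ : DirichletCharacter ℂ D),
      3 ≤ D → Odd D → χ.IsQuadratic → χ.IsPrimitive → χ.Odd →
        c₁ / Real.log D ^ N < ‖χ.LFunction 1‖ :=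
  lOneLowerBound_oddLevel_of_sigma_weak hA hσ hsum hN
    (conreyIwaniec2002_theorem11_weak_of_proposition81 h81) h

/-- **The leaf's full exponent on the weak chain**: on the edge `κ + σ < 2003/2027` (`σ > 0`),
`H_Σ(κ,σ)` and the weak Theorem 1.1 give the odd-level odd half with exponent `2022`
(`A = 2003/4`, `4A + 19 = 2022`; deck 19b: `κ + σ < 501/507` with `A = 501`). -/
theorem lOneLowerBound_oddLevel_2022_of_sigma_weak {κ σ : ℝ} (hσ : 0 < σ)
    (hsum : κ + σ < 2003 / 2027) (hCI : conreyIwaniec2002_theorem11_weak)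
    (h : SubnormalGapsHypothesisSigma κ σ) :
    ∃ c₁ : ℝ, 0 < c₁ ∧ ∀ (D : ℕ) [NeZero D] (χ : DirichletCharacter ℂ D),
      3 ≤ D → Odd D → χ.IsQuadratic → χ.IsPrimitive → χ.Odd →
        c₁ / Real.log D ^ 2022 < ‖χ.LFunction 1‖ :=
  lOneLowerBound_oddLevel_of_sigma_weak (A := 2003 / 4) (by norm_num) hσ (by norm_num; linarith)
    (by norm_num) hCI h

/-- **Conrey–Iwaniec's interior point on the weak chain**: `X` (any `c > 0`) and the weak Theorem 1.1
give the odd-level odd half with exponent `76` (`κ = 1/5`, `σ = 1/2`, any `A > 14` works and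
`N ≥ 4A + 19 > 75` forces `N ≥ 76`; here `A = 57/4`, `4A + 19 = 76`; deck 19b: `75`; printed
Theorem 1.2: `90`). Typed ≠ proved for `X` and the weak Theorem 1.1; this is NOT a proof of (1.22). -/
theorem lOneLowerBound_oddLevel_76_of_subnormalGaps_weak {c : ℝ} (hc : 0 < c)
    (hX : SubnormalGapsHypothesis c) (hCI : conreyIwaniec2002_theorem11_weak) :
    ∃ c₁ : ℝ, 0 < c₁ ∧ ∀ (D : ℕ) [NeZero D] (χ : DirichletCharacter ℂ D),
      3 ≤ D → Odd D → χ.IsQuadratic → χ.IsPrimitive → χ.Odd →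
        c₁ / Real.log D ^ 76 < ‖χ.LFunction 1‖ :=
  lOneLowerBound_oddLevel_of_sigma_weak (A := 57 / 4) (by norm_num) (by norm_num : (0:ℝ) < 1 / 2)
    (by norm_num) (by norm_num) hCI (sigma_half_of_subnormalGaps hc hX)

/-- **The interior point from the typed Proposition 8.1 BY NAME**: `X ∧ Prop 8.1 ⟹` the odd-level odd
half of the leaf with exponent `76`. This is the kernel form of the CI-GAPS door «`X ⇒ odd 75` via
Theorem 1.1 mod FACT `conreyIwaniec2002_theorem11`» with the fact boundary moved to Conrey–Iwaniec's
Proposition 8.1 (§§5–8) — at the price of one power of `log q` and the restriction to odd level. -/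
theorem lOneLowerBound_oddLevel_76_of_subnormalGaps_of_proposition81 {c : ℝ} (hc : 0 < c)
    (hX : SubnormalGapsHypothesis c) (h81 : conreyIwaniec2002_proposition81) :
    ∃ c₁ : ℝ, 0 < c₁ ∧ ∀ (D : ℕ) [NeZero D] (χ : DirichletCharacter ℂ D),
      3 ≤ D → Odd D → χ.IsQuadratic → χ.IsPrimitive → χ.Odd →
        c₁ / Real.log D ^ 76 < ‖χ.LFunction 1‖ :=
  lOneLowerBound_oddLevel_76_of_subnormalGaps_weak hc hX
    (conreyIwaniec2002_theorem11_weak_of_proposition81 h81)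

/-- The leaf-compatible reading on the weak chain: exponent `4A + 19 ≤ 2022 ⇔ A ≤ 2003/4`, and then
`A/(A+6) ≤ 2003/2027`: the weak edge of K-L24-1 is the segment `κ + σ < 2003/2027`
(deck 19b `sigma_leaf_budget`: `501/507`; cf. `dedekind_budget_weak_iff`). -/
theorem sigma_leaf_budget_weak {A : ℝ} (hA : 0 ≤ A) (hE : 4 * A + 19 ≤ 2022) :
    A / (A + 6) ≤ 2003 / 2027 := by
  have h1 : A ≤ 2003 / 4 := by linarith
  have h2 : 0 < A + 6 := by linarith
  rw [div_le_div_iff₀ h2 (by norm_num)]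
  nlinarith

/-! ### The parity caveat at the leaf, exactly: `LOneLowerBoundOdd 76` = odd-level half (kernel, mod `X ∧ Prop 8.1`) ∧ even-level half (open) -/

/-- **What the weak chain leaves open of the odd half of the leaf.** `LOneLowerBoundOdd N` (all moduli
`D ≥ 3`) follows from the odd-LEVEL statement (the conclusion of `lOneLowerBound_oddLevel_of_sigma_weak`)
together with its even-LEVEL sibling — odd real primitive characters of even conductor (`D = 4m`, `m`
squarefree, `m ≢ 3 (mod 4)`: the fields `ℚ(√−1)`, `ℚ(√−2)`, `ℚ(√−5)`, …), which Conrey–Iwaniec §§7–10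
(standing on `q` odd) do not reach. Proved bookkeeping (`Nat.even_or_odd`, smaller constant); nothing
asserted about either conjunct. Private: the public form, with the two level-halves NAMED, lives in the
companion Literature file `LOneLowerBoundOddLevelHalves.lean`. -/
private theorem lOneLowerBoundOdd_of_oddLevel_of_evenLevel {N : ℕ}
    (h₁ : ∃ c₁ : ℝ, 0 < c₁ ∧ ∀ (D : ℕ) [NeZero D] (χ : DirichletCharacter ℂ D),
      3 ≤ D → Odd D → χ.IsQuadratic → χ.IsPrimitive → χ.Odd →
        c₁ / Real.log D ^ N < ‖χ.LFunction 1‖)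
    (h₂ : ∃ c₂ : ℝ, 0 < c₂ ∧ ∀ (D : ℕ) [NeZero D] (χ : DirichletCharacter ℂ D),
      3 ≤ D → Even D → χ.IsQuadratic → χ.IsPrimitive → χ.Odd →
        c₂ / Real.log D ^ N < ‖χ.LFunction 1‖) :
    LOneLowerBoundOdd N := by
  obtain ⟨c₁, hc₁, h₁⟩ := h₁
  obtain ⟨c₂, hc₂, h₂⟩ := h₂
  refine ⟨min c₁ c₂, lt_min hc₁ hc₂, fun D _ χ hD hq hp ho => ?_⟩
  have hpow : 0 < Real.log (D : ℝ) ^ N := by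
    have h3 : (3 : ℝ) ≤ D := by exact_mod_cast hD
    exact pow_pos (Real.log_pos (by linarith)) N
  rcases Nat.even_or_odd D with hev | hod
  · calc min c₁ c₂ / Real.log D ^ N ≤ c₂ / Real.log D ^ N :=
          div_le_div_of_nonneg_right (min_le_right _ _) hpow.le
      _ < ‖χ.LFunction 1‖ := h₂ D χ hD hev hq hp ho
  · calc min c₁ c₂ / Real.log D ^ N ≤ c₁ / Real.log D ^ N :=
          div_le_div_of_nonneg_right (min_le_left _ _) hpow.le
      _ < ‖χ.LFunction 1‖ := h₁ D χ hD hod hq hp ho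

/-- **The door of record after the re-thread, as one statement**: `X` (any `c > 0`), the typed
Proposition 8.1, and the even-LEVEL odd-character bound with exponent `76` (the part outside the
Conrey–Iwaniec scope, an explicit hypothesis) give `LOneLowerBoundOdd 76`. Shows exactly which
conjunct the kernel chain does not supply; nothing asserted about it. -/
theorem lOneLowerBoundOdd_76_of_subnormalGaps_of_proposition81_of_evenLevel {c : ℝ} (hc : 0 < c)
    (hX : SubnormalGapsHypothesis c) (h81 : conreyIwaniec2002_proposition81)
    (heven : ∃ c₂ : ℝ, 0 < c₂ ∧ ∀ (D : ℕ) [NeZero D] (χ : DirichletCharacter ℂ D),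
      3 ≤ D → Even D → χ.IsQuadratic → χ.IsPrimitive → χ.Odd →
        c₂ / Real.log D ^ 76 < ‖χ.LFunction 1‖) :
    LOneLowerBoundOdd 76 :=
  lOneLowerBoundOdd_of_oddLevel_of_evenLevel
    (lOneLowerBound_oddLevel_76_of_subnormalGaps_of_proposition81 hc hX h81) heven

/-! ### §5w′ (v2, append) The same conclusions BY NAME: `LOneLowerBoundOddOddLevel N` of the companion
Literature file `LOneLowerBoundOddLevelHalves.lean` (p625236) — definitionally the spelled-out statements above -/

/-- **K-L24-1 reaches `LOneLowerBoundOddOddLevel N`** (`N ≥ 4A+19`, weak Theorem 1.1): the named form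
of `lOneLowerBound_oddLevel_of_sigma_weak` (the predicate unfolds to its conclusion). -/
theorem lOneLowerBoundOddOddLevel_of_sigma_weak {κ σ A : ℝ} {N : ℕ} (hA : 0 ≤ A) (hσ : 0 < σ)
    (hsum : κ + σ < A / (A + 6)) (hN : 4 * A + 19 ≤ N) (hCI : conreyIwaniec2002_theorem11_weak)
    (h : SubnormalGapsHypothesisSigma κ σ) : LOneLowerBoundOddOddLevel N :=
  lOneLowerBound_oddLevel_of_sigma_weak hA hσ hsum hN hCI h

/-- **K-L24-1 reaches `LOneLowerBoundOddOddLevel N` from the typed Proposition 8.1 BY NAME**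
(`N ≥ 4A+19`). -/
theorem lOneLowerBoundOddOddLevel_of_sigma_of_proposition81 {κ σ A : ℝ} {N : ℕ} (hA : 0 ≤ A)
    (hσ : 0 < σ) (hsum : κ + σ < A / (A + 6)) (hN : 4 * A + 19 ≤ N)
    (h81 : conreyIwaniec2002_proposition81) (h : SubnormalGapsHypothesisSigma κ σ) :
    LOneLowerBoundOddOddLevel N :=
  lOneLowerBound_oddLevel_of_sigma_of_proposition81 hA hσ hsum hN h81 h

/-- **The leaf's full exponent, named**: `H_Σ(κ,σ)` on the weak edge `κ + σ < 2003/2027` and the weak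
Theorem 1.1 give `LOneLowerBoundOddOddLevel 2022`. -/
theorem lOneLowerBoundOddOddLevel_2022_of_sigma_weak {κ σ : ℝ} (hσ : 0 < σ)
    (hsum : κ + σ < 2003 / 2027) (hCI : conreyIwaniec2002_theorem11_weak)
    (h : SubnormalGapsHypothesisSigma κ σ) : LOneLowerBoundOddOddLevel 2022 :=
  lOneLowerBound_oddLevel_2022_of_sigma_weak hσ hsum hCI h

/-- **The interior point, named**: `X ∧ Prop 8.1 ⟹ LOneLowerBoundOddOddLevel 76` — the (κ,σ)-edge
reading of the CI-GAPS door with its fact boundary at Conrey–Iwaniec §§5–8 (the leaf-level door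
through Corollary 10.2 gives `LOneLowerBoundOddOddLevel 90`, `lOneLowerBoundOddOddLevel_of_proposition81`).
Typed ≠ proved for `X` and Proposition 8.1. -/
theorem lOneLowerBoundOddOddLevel_76_of_subnormalGaps_of_proposition81 {c : ℝ} (hc : 0 < c)
    (hX : SubnormalGapsHypothesis c) (h81 : conreyIwaniec2002_proposition81) :
    LOneLowerBoundOddOddLevel 76 :=
  lOneLowerBound_oddLevel_76_of_subnormalGaps_of_proposition81 hc hX h81

/-- **What remains of the odd half at exponent `76`** (proved bookkeeping): given `X` and the typed
Proposition 8.1, `LOneLowerBoundOdd 76 ↔ LOneLowerBoundOddEvenLevel 76` — the even-LEVEL odd-character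
conjunct, outside every `q`-odd statement of Conrey–Iwaniec. Nothing asserted about it. -/
theorem lOneLowerBoundOdd_76_iff_evenLevel_of_subnormalGaps_of_proposition81 {c : ℝ} (hc : 0 < c)
    (hX : SubnormalGapsHypothesis c) (h81 : conreyIwaniec2002_proposition81) :
    LOneLowerBoundOdd 76 ↔ LOneLowerBoundOddEvenLevel 76 :=
  ⟨lOneLowerBoundOddEvenLevel_of_lOneLowerBoundOdd,
    fun he => Literature.NumberTheory.LFunctions.lOneLowerBoundOdd_of_oddLevel_of_evenLevel
      (lOneLowerBoundOddOddLevel_76_of_subnormalGaps_of_proposition81 hc hX h81) he⟩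

end Summit.Parity.GeneralizedHardyLittlewood.Theorems.PrimeLevelFamEdgeIdeaDeltas.WucSigma

end
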